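import Summits.NavierStokesRegularity.NavierStokesRegularity.Theses.TypeIQuarterGate
import Summits.NavierStokesRegularity.NavierStokesRegularity.Theorems.TypeIQuarterGateLorentzCeilingSparsitySampled
import Summits.NavierStokesRegularity.NavierStokesRegularity.Theorems.TypeIQuarterGateLorentzCeilingSparsityByName
import Summits.NavierStokesRegularity.NavierStokesRegularity.Theorems.TypeIQuarterGateQuarterLawTypeISamplingTFAE
import Literature.Analysis.FunctionSpaces.WeakLp
import HarnessLib

/-!
# `TypeIQuarterGate`: BY NAME — `LorentzUpgradeTypeI` ⟺ near-ceiling sparsity at the DYADIC TIMES only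
# (crux `QuarterLawTypeI`, stmt-NavierStokesRegularity-23726; open stub `stub_lorentzUpgrade` = item 24108)

`--supports stmt-NavierStokesRegularity-23726` (helper, def-free).  Corollaries of
`LorentzCeiling.count_of_sampledCeilingSparsity` (file `TypeIQuarterGateLorentzCeilingSparsitySampled.lean`)
at the dyadic times `t_n = T − T/2^{n+1}` (tree bookkeeping `QuarterLawOctave.dyadic_mem_Ico`,
`tendsto_dyadic`, `dyadic_ratio`):

* `lorentzBound_of_dyadicCeilingSparsity` / `quarterLaw_of_dyadicCeilingSparsity` — along a sup-norm
  Type-I maximal classical Leray–Hopf blow-up from a rapidly decaying datum, the bounds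
  `(κ 2^{(n+1)/2}/√T)³ · |{x : ‖u(t_n,x)‖ > κ 2^{(n+1)/2}/√T}| ≤ M(κ)` (every fraction `κ > 0`, every
  `n`) give the FULL weak-`L³` bound on `[0,T)` and Leray's quarter law;
* BY NAME: `lorentzUpgradeTypeI_iff_dyadicCeilingSparsity`, `quarterLawTypeI_iff_dyadicCeilingSparsity`.

Repair-census wording for 23726/24108 (sharpest dictionary entry of this session): the missing estimate
is a weak-type bound at COUNTABLY MANY SLICES (the dyadic times) and, on each, only at the levels within
a fixed factor of the Type-I ceiling `C/√(T−t_n)` — uniformly in `n` for each fixed fraction.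

HONEST FRAMING: a-priori statements along a HYPOTHETICAL Type-I blow-up; `LorentzUpgradeTypeI` (24108),
`QuarterLawTypeI` (23726) remain OPEN; nothing about Navier–Stokes regularity or blow-up is claimed and
no summit statement is proved. [folklore]
-/

noncomputable section

-- the summit-side namespace repeats a component by design (D-0017)
set_option linter.dupNamespace false

namespace Summit.NavierStokesRegularity.NavierStokesRegularity.Theorems.LorentzCeiling

open Set MeasureTheory Function Metric Filter Topology
open scoped ENNReal NNReal
open Literature.Analysis.FluidPDE Literature.Analysis.FunctionSpaces
open Summit.NavierStokesRegularity.NavierStokesRegularity.Theorems.CountQuarterLaw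

variable {ν T : ℝ} {u : ℝ → EuclideanSpace ℝ (Fin 3) → EuclideanSpace ℝ (Fin 3)}
  {p : ℝ → EuclideanSpace ℝ (Fin 3) → ℝ}

/-- The dyadic times `T − T/2^{n+1}` meet every backward window `δ ≤ T − t ≤ 2δ`, `0 < δ ≤ T/2`.
[folklore] -/
theorem dyadicTimes_meet_windows (T : ℝ) :
    ∀ δ : ℝ, 0 < δ → δ ≤ T / 2 → ∃ t ∈ Set.range (fun n : ℕ => T - T / 2 ^ (n + 1)),
      t ∈ Ico 0 T ∧ δ ≤ T - t ∧ T - t ≤ 2 * δ := by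
  intro δ hδ hδT
  classical
  have hT : 0 < T := by linarith
  set ts : ℕ → ℝ := fun n => T - T / 2 ^ (n + 1) with hts
  have hev : ∃ m, T - ts m < δ := by
    have h1 : Tendsto (fun n => T - ts n) atTop (𝓝 (T - T)) :=
      tendsto_const_nhds.sub (QuarterLawOctave.tendsto_dyadic T)
    rw [sub_self] at h1
    exact (h1.eventually (gt_mem_nhds hδ)).exists
  set m : ℕ := Nat.find hev with hm_def
  have hm : T - ts m < δ := Nat.find_spec hev
  have hm0 : m ≠ 0 := by
    intro h0
    rw [h0] at hm
    have : T - ts 0 = T / 2 := by simp only [hts]; ring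
    linarith
  obtain ⟨n, hn⟩ := Nat.exists_eq_succ_of_ne_zero hm0
  have hnm : n < m := by rw [hn]; exact Nat.lt_succ_self n
  have hnδ : δ ≤ T - ts n := by
    have := Nat.find_min hev hnm
    rwa [not_lt] at this
  have hsucc : T - ts (n + 1) < δ := by
    have e : n + 1 = m := by rw [hn]
    rw [e]; exact hm
  refine ⟨ts n, ⟨n, rfl⟩, QuarterLawOctave.dyadic_mem_Ico hT n, hnδ, ?_⟩
  calc T - ts n ≤ 2 * (T - ts (n + 1)) := QuarterLawOctave.dyadic_ratio T n
    _ ≤ 2 * δ := by linarith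

/-- **Near-ceiling sparsity at the dyadic times ⟹ the FULL weak-`L³` bound**, along a maximal classical
Leray–Hopf solution from a rapidly decaying datum with the sup-norm Type-I rate at `T`
(`count_of_sampledCeilingSparsity` with `S` = the dyadic times, `q = 2`; then the tree's
`LorentzOfEnvelope.lorentzBound_of_count`). [cite: BarkerPrange2020, Thm 1] -/
theorem lorentzBound_of_dyadicCeilingSparsity (hν : 0 < ν) (hT : 0 < T)
    (hmax : IsMaximalSmoothSolution ν 0 u p T) (hLH : IsLerayHopfOn T ν 0 (u 0) u)
    (hdec : HasRapidSpatialDecay (u 0)) (hI : IsTypeIBlowup u T)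
    (hdy : ∀ κ : ℝ, 0 < κ → ∃ M : ℝ, ∀ n : ℕ,
      ENNReal.ofReal ((κ / Real.sqrt (T / 2 ^ (n + 1))) ^ 3) *
        volume {x | κ / Real.sqrt (T / 2 ^ (n + 1)) < ‖u (T - T / 2 ^ (n + 1)) x‖} ≤
          ENNReal.ofReal M) :
    ∃ M' : ℝ, ∀ t ∈ Ico 0 T, eWeakLpPow (u t) 3 volume ≤ ENNReal.ofReal M' := by
  refine LorentzOfEnvelope.lorentzBound_of_count hν hT hmax.1 hLH hdec hI
    (count_of_sampledCeilingSparsity hν hT hmax hLH hdec hI (S := Set.range fun n : ℕ =>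
      T - T / 2 ^ (n + 1)) (q := 2) (δ₀ := T / 2) (by positivity) (dyadicTimes_meet_windows T) ?_)
  intro κ hκ
  obtain ⟨M, hM⟩ := hdy κ hκ
  refine ⟨M, ?_⟩
  rintro t ⟨n, rfl⟩ _
  have h := hM n
  simp only [sub_sub_cancel]
  exact h

/-- **Near-ceiling sparsity at the dyadic times ⟹ Leray's quarter law** on `[0,T)` (same, with the
registered stub `CountQuarterLaw.stub_countQuarterLaw`). [cite: BarkerPrange2020, Thm 1] -/
theorem quarterLaw_of_dyadicCeilingSparsity (hν : 0 < ν) (hT : 0 < T)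
    (hmax : IsMaximalSmoothSolution ν 0 u p T) (hLH : IsLerayHopfOn T ν 0 (u 0) u)
    (hdec : HasRapidSpatialDecay (u 0)) (hI : IsTypeIBlowup u T)
    (hdy : ∀ κ : ℝ, 0 < κ → ∃ M : ℝ, ∀ n : ℕ,
      ENNReal.ofReal ((κ / Real.sqrt (T / 2 ^ (n + 1))) ^ 3) *
        volume {x | κ / Real.sqrt (T / 2 ^ (n + 1)) < ‖u (T - T / 2 ^ (n + 1)) x‖} ≤
          ENNReal.ofReal M) :
    ∃ K : ℝ, ∀ t ∈ Ico 0 T, ∫⁻ x, ‖curl (u t) x‖ₑ ^ 2 ≤ ENNReal.ofReal (K / Real.sqrt (T - t)) := by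
  refine stub_countQuarterLaw ν T hν hT u p hmax hLH hdec hI
    (count_of_sampledCeilingSparsity hν hT hmax hLH hdec hI (S := Set.range fun n : ℕ =>
      T - T / 2 ^ (n + 1)) (q := 2) (δ₀ := T / 2) (by positivity) (dyadicTimes_meet_windows T) ?_)
  intro κ hκ
  obtain ⟨M, hM⟩ := hdy κ hκ
  refine ⟨M, ?_⟩
  rintro t ⟨n, rfl⟩ _
  have h := hM n
  simp only [sub_sub_cancel]
  exact h

/-- **Uniform weak-`L³` bound ⟹ near-ceiling sparsity at the dyadic times** (read the bound at the
level `κ 2^{(n+1)/2}/√T` and the time `T − T/2^{n+1}`). [folklore] -/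
theorem dyadicCeilingSparsity_of_lorentzBound (hT : 0 < T)
    (hW : ∃ M' : ℝ, ∀ t ∈ Ico 0 T, eWeakLpPow (u t) 3 volume ≤ ENNReal.ofReal M') :
    ∀ κ : ℝ, 0 < κ → ∃ M : ℝ, ∀ n : ℕ,
      ENNReal.ofReal ((κ / Real.sqrt (T / 2 ^ (n + 1))) ^ 3) *
        volume {x | κ / Real.sqrt (T / 2 ^ (n + 1)) < ‖u (T - T / 2 ^ (n + 1)) x‖} ≤
          ENNReal.ofReal M := by
  obtain ⟨M', hM'⟩ := hW
  intro κ hκ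
  refine ⟨M', fun n => ?_⟩
  exact (ofReal_cube_mul_meas_lt_le_eWeakLpPow (u (T - T / 2 ^ (n + 1))) volume
    (div_nonneg hκ.le (Real.sqrt_nonneg _))).trans (hM' _ (QuarterLawOctave.dyadic_mem_Ico hT n))

/-! ### BY NAME -/

open Summit.NavierStokesRegularity.NavierStokesRegularity.Theses.TypeIQuarterGate

/-- **BY NAME: `LorentzUpgradeTypeI` ⟺ NEAR-CEILING SPARSITY AT THE DYADIC TIMES.**  The open item 24108
is equivalent to: along every sup-norm Type-I maximal classical Leray–Hopf blow-up from a rapidly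
decaying datum, for every fraction `κ > 0` there is `M` with
`(κ_n)³ · |{x : κ_n < ‖u(T − T/2^{n+1}, x)‖}| ≤ M` for all `n`, `κ_n = κ/√(T/2^{n+1})` — countably many
slices, and on each only the levels at fixed fractions of the Type-I ceiling.  `LorentzUpgradeTypeI`
remains OPEN. [folklore] -/
theorem lorentzUpgradeTypeI_iff_dyadicCeilingSparsity :
    LorentzUpgradeTypeI ↔
      ∀ (ν T : ℝ), 0 < ν → 0 < T →
        ∀ (u : ℝ → EuclideanSpace ℝ (Fin 3) → EuclideanSpace ℝ (Fin 3))
          (p : ℝ → EuclideanSpace ℝ (Fin 3) → ℝ),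
          IsMaximalSmoothSolution ν 0 u p T → IsLerayHopfOn T ν 0 (u 0) u →
          HasRapidSpatialDecay (u 0) → IsTypeIBlowup u T →
          ∀ κ : ℝ, 0 < κ → ∃ M : ℝ, ∀ n : ℕ,
            ENNReal.ofReal ((κ / Real.sqrt (T / 2 ^ (n + 1))) ^ 3) *
              volume {x | κ / Real.sqrt (T / 2 ^ (n + 1)) < ‖u (T - T / 2 ^ (n + 1)) x‖} ≤
                ENNReal.ofReal M := by
  unfold LorentzUpgradeTypeI
  constructor
  · intro h ν T hν hT u p hmax hLH hdec hI
    exact dyadicCeilingSparsity_of_lorentzBound hT (h ν T hν hT u p hmax hLH hdec hI)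
  · intro h ν T hν hT u p hmax hLH hdec hI
    exact lorentzBound_of_dyadicCeilingSparsity hν hT hmax hLH hdec hI
      (h ν T hν hT u p hmax hLH hdec hI)

/-- **BY NAME: the crux `QuarterLawTypeI` ⟺ near-ceiling sparsity at the dyadic times** along Type-I
blow-ups (via the tree's `LorentzOfEnvelope.lorentzUpgradeTypeI_iff_quarterLawTypeI`).
`QuarterLawTypeI` remains OPEN. [folklore] -/
theorem quarterLawTypeI_iff_dyadicCeilingSparsity :
    QuarterLawTypeI ↔
      ∀ (ν T : ℝ), 0 < ν → 0 < T →
        ∀ (u : ℝ → EuclideanSpace ℝ (Fin 3) → EuclideanSpace ℝ (Fin 3))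
          (p : ℝ → EuclideanSpace ℝ (Fin 3) → ℝ),
          IsMaximalSmoothSolution ν 0 u p T → IsLerayHopfOn T ν 0 (u 0) u →
          HasRapidSpatialDecay (u 0) → IsTypeIBlowup u T →
          ∀ κ : ℝ, 0 < κ → ∃ M : ℝ, ∀ n : ℕ,
            ENNReal.ofReal ((κ / Real.sqrt (T / 2 ^ (n + 1))) ^ 3) *
              volume {x | κ / Real.sqrt (T / 2 ^ (n + 1)) < ‖u (T - T / 2 ^ (n + 1)) x‖} ≤
                ENNReal.ofReal M :=
  LorentzOfEnvelope.lorentzUpgradeTypeI_iff_quarterLawTypeI.symm.trans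
    lorentzUpgradeTypeI_iff_dyadicCeilingSparsity

end Summit.NavierStokesRegularity.NavierStokesRegularity.Theorems.LorentzCeiling

end
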